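import Literature.Analysis.FluidPDE.NSLocalAnalyticityRadiusLocalisedField
import Literature.Analysis.FluidPDE.ClassicalSuitableRegion
import Literature.Analysis.FluidPDE.CaloricRemainderCalculus
import HarnessLib

/-!
# The localised system tested against a solenoidal field: the slice identity

Analysis/FluidPDE proofs-layer file (theorems only), module L2a of the proof of the named fact
`Literature.Analysis.FluidPDE.bradshawGrujicKukavica2015_local_analyticity_radius`
(Bradshaw–Grujić–Kukavica 2015, Thm. 2.3, §4). For a classical solution `(u, p)` on the open
cylinder `(-δ, R²) × B(x₁, R)` (`BGK2015.IsCylinderSolution`), an admissible cut-off `χ`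
(`BGK2015.IsLocCutoff`) and the localised objects `v = χu`, `ũ = 1_{B(x₁,R-2)}u`,
`f₀ = (Δχ)u + (u·∇χ)u + p∇χ` (`NSLocalAnalyticityRadiusLocalisation.lean`), the localised
momentum equation `∂ₜv = χ(Δu - (u·∇)u - ∇p)` (BGK 2015, (4.2)) tested at a fixed time `s`
against a `C²` **divergence-free** field `Ψ` (not necessarily compactly supported — the
compact support is carried by `v(s)`) reads

  `∫ ⟪∂ₜv(s), Ψ⟫ - ∫ ⟪v(s), ΔΨ⟫ = ∫ ⟪f₀(s), Ψ⟫ + ∫ ⟪ũ(s), DΨ(v(s))⟫ + ∫ ⟪ũ(s), DΨ(2∇χ)⟫`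

(`integral_inner_deriv_locVelocity_sub`): the viscous term is moved onto `Ψ`
(`∫ χ⟪Δu, Ψ⟫ = ∫ ⟪u, Δ(χΨ)⟫`), the convection term by the trilinear identity
(`∫ χ⟪(u·∇)u, Ψ⟫ = -∫ ⟪u, (u·∇)(χΨ)⟫`, `div u = 0` on `supp χ`), and the pressure disappears
up to the commutator (`∫ χ⟪∇p, Ψ⟫ = -∫ p div(χΨ) = -∫ p ∇χ·Ψ` since `div Ψ = 0`) — the three
whole-space integrations by parts of `WholeSpaceIBP`, applied to globally smooth cut-off
representatives of `u(s)`, `p(s)` (`exists_contDiff_tsupport_subset_eventuallyEq_one`), followed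
by the Leibniz rules for `Δ(χΨ)`, `(u·∇)(χΨ)`, `div(χΨ)`. With `Ψ = e^{(t-s)Δ}φ` this is the
time derivative of the duality pairing `⟨v(s), e^{(t-s)Δ}φ⟩` (next file).

## Mathlib / tree search

Tree: `integral_inner_laplacian_comm`, `integral_inner_convect_add_eq_zero`,
`integral_inner_gradient_eq_neg_integral_mul_divergence`, `divergence_smul_apply`
(`WholeSpaceIBP`); `laplacian_smul_field`, `convect_smul_field` (`CaloricRemainderCalculus`);
`exists_contDiff_tsupport_subset_eventuallyEq_one`, `contDiff_cutoff_smul_of_contDiffOn`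
(`ClassicalSuitableRegion`); module L1 (`deriv_locVelocity_eq`, `contDiff_locForce`, …).
Mathlib: `InnerProductSpace.laplacian_congr_nhds`, `Filter.EventuallyEq.fderiv_eq`,
`nhds_le_nhdsSet`.

## References

* Z. Bradshaw, Z. Grujić, I. Kukavica, J. Differential Equations 259 (2015), §4, (4.2)–(4.3).
  [BradshawGrujicKukavica2015]
* J. Leray, Acta Math. 63 (1934), §6 (1.11) and (17) (testing against solenoidal fields).
  [Leray1934]
-/

noncomputable section

open MeasureTheory Set Function Filter Metric Real
open _root_.Topology
open scoped ENNReal ContDiff Laplacian InnerProductSpace RealInnerProductSpace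

namespace Literature.Analysis.FluidPDE

namespace BGK2015

variable {x₁ : EuclideanSpace ℝ (Fin 3)} {δ R : ℝ}
  {u : ℝ → EuclideanSpace ℝ (Fin 3) → EuclideanSpace ℝ (Fin 3)}
  {p : ℝ → EuclideanSpace ℝ (Fin 3) → ℝ} {χ : EuclideanSpace ℝ (Fin 3) → ℝ}

/-! ### Globally smooth representatives of the slices -/

/-- **Cut-off representatives of the slices.** At a time `s ∈ (-δ, R²)` there are globally smooth
fields `U`, `P` on `ℝ³` which agree with `u(s)`, `p(s)` as germs at every point of the closed
ball `B̄(x₁, R - 2)` (the standard cut-off device: `U = ζ u(s)`, `P = ζ p(s)` with `ζ ≡ 1`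
near that ball and supported in `B(x₁, R)`). [folklore] -/
theorem IsCylinderSolution.exists_global_representatives (hsol : IsCylinderSolution x₁ δ R u p)
    {s : ℝ} (hs : s ∈ Ioo (-δ) (R ^ 2)) :
    ∃ (U : EuclideanSpace ℝ (Fin 3) → EuclideanSpace ℝ (Fin 3)) (P : EuclideanSpace ℝ (Fin 3) → ℝ),
      ContDiff ℝ ∞ U ∧ ContDiff ℝ ∞ P ∧
        ∀ x ∈ closedBall x₁ (R - 2), U =ᶠ[𝓝 x] u s ∧ P =ᶠ[𝓝 x] p s := by
  obtain ⟨ζ, hζ, -, hζO, hζ1⟩ := exists_contDiff_tsupport_subset_eventuallyEq_one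
    (isCompact_closedBall x₁ (R - 2)) isOpen_ball
    (closedBall_subset_ball (by linarith : R - 2 < R))
  refine ⟨fun x => ζ x • u s x, fun x => ζ x • p s x,
    contDiff_cutoff_smul_of_contDiffOn isOpen_ball hζ hζO (hsol.contDiffOn_velocity_slice hs),
    contDiff_cutoff_smul_of_contDiffOn isOpen_ball hζ hζO (hsol.contDiffOn_pressure_slice hs),
    fun x hx => ?_⟩
  have hev : ∀ᶠ y in 𝓝 x, ζ y = 1 := hζ1.filter_mono (nhds_le_nhdsSet hx)
  exact ⟨hev.mono fun y hy => by simp [hy], hev.mono fun y hy => by simp [hy]⟩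

/-! ### Pointwise Leibniz rules for `χ Ψ` -/

/-- `Σᵢ (∂ᵢχ) ∂ᵢΨ = DΨ(∇χ)` for the standard frame. [folklore] -/
theorem sum_fderiv_stdBasis_smul_fderiv_eq (χ : EuclideanSpace ℝ (Fin 3) → ℝ)
    (Ψ : EuclideanSpace ℝ (Fin 3) → EuclideanSpace ℝ (Fin 3)) (x : EuclideanSpace ℝ (Fin 3)) :
    ∑ i, (fderiv ℝ χ x (stdOrthonormalBasis ℝ (EuclideanSpace ℝ (Fin 3)) i)) •
        fderiv ℝ Ψ x (stdOrthonormalBasis ℝ (EuclideanSpace ℝ (Fin 3)) i) =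
      fderiv ℝ Ψ x (gradient χ x) :=
  sum_fderiv_smul_fderiv_eq _ χ Ψ x

/-! ### The slice identity -/

section Slice

variable (hsol : IsCylinderSolution x₁ δ R u p) (hχ : IsLocCutoff x₁ R χ) {s : ℝ}
  (hs : s ∈ Ioo (-δ) (R ^ 2)) {Ψ : EuclideanSpace ℝ (Fin 3) → EuclideanSpace ℝ (Fin 3)}
  (hΨ : ContDiff ℝ 2 Ψ) (hΨdiv : VectorCalculus.IsDivFree Ψ)
include hsol hχ hs hΨ hΨdiv

/-- **The localised momentum equation tested against a solenoidal `C²` field** (slice identity):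
`∫ ⟪∂ₜv(s), Ψ⟫ - ∫ ⟪v(s), ΔΨ⟫ = ∫ ⟪f₀(s), Ψ⟫ + ∫ ⟪ũ(s), DΨ(v(s))⟫ + ∫ ⟪ũ(s), DΨ(2∇χ)⟫`
for every `C²` field `Ψ` with `div Ψ = 0` (no decay of `Ψ` is needed: every integrand carries a
factor supported in `supp χ`). [cite: BradshawGrujicKukavica2015, §4 (4.2)–(4.3)] -/
theorem integral_inner_deriv_locVelocity_sub :
    (∫ x, ⟪deriv (fun σ => locVelocity χ u σ x) s, Ψ x⟫) -
        ∫ x, ⟪locVelocity χ u s x, (Δ Ψ) x⟫ =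
      (∫ x, ⟪locForce χ u p s x, Ψ x⟫) +
        (∫ x, ⟪locExtension x₁ R u s x, fderiv ℝ Ψ x (locVelocity χ u s x)⟫) +
        ∫ x, ⟪locExtension x₁ R u s x, fderiv ℝ Ψ x ((2 : ℝ) • gradient χ x)⟫ := by
  obtain ⟨U, P, hU, hP, hgerm⟩ := hsol.exists_global_representatives hs
  -- regularity
  have hU2 : ContDiff ℝ 2 U := hU.of_le (by norm_cast)
  have hU1 : ContDiff ℝ 1 U := hU.of_le (by norm_cast)
  have hP1 : ContDiff ℝ 1 P := hP.of_le (by norm_cast)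
  have hχ2 : ContDiff ℝ 2 χ := hχ.contDiff.of_le (by norm_cast)
  have hχ1 : ContDiff ℝ 1 χ := hχ.contDiff.of_le (by norm_cast)
  have hΨ1 : ContDiff ℝ 1 Ψ := hΨ.of_le one_le_two
  set ψ : EuclideanSpace ℝ (Fin 3) → EuclideanSpace ℝ (Fin 3) := fun x => χ x • Ψ x with hψdef
  have hψ2 : ContDiff ℝ 2 ψ := hχ2.smul hΨ
  have hψ1 : ContDiff ℝ 1 ψ := hψ2.of_le one_le_two
  have hψsupp : tsupport ψ ⊆ tsupport χ := tsupport_smul_subset_left χ Ψ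
  have hψc : HasCompactSupport ψ := hχ.hasCompactSupport.mono' ((subset_tsupport _).trans hψsupp)
  -- values and germs on `supp χ ⊆ B̄(x₁, R - 3) ⊆ B̄(x₁, R - 2)`
  have hKχ : ∀ x ∈ tsupport χ, x ∈ closedBall x₁ (R - 2) := fun x hx =>
    closedBall_subset_closedBall (by linarith) (hχ.tsupport_subset hx)
  have hUx : ∀ x ∈ tsupport χ, U x = u s x := fun x hx => (hgerm x (hKχ x hx)).1.eq_of_nhds
  have hPx : ∀ x ∈ tsupport χ, P x = p s x := fun x hx => (hgerm x (hKχ x hx)).2.eq_of_nhds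
  have hũx : ∀ x ∈ tsupport χ, locExtension x₁ R u s x = u s x := fun x hx =>
    locExtension_eq_of_mem_tsupport hχ hx
  have hvU : ∀ x, locVelocity χ u s x = χ x • U x := by
    intro x
    by_cases hx : x ∈ tsupport χ
    · rw [locVelocity_apply, hUx x hx]
    · rw [locVelocity_apply, image_eq_zero_of_notMem_tsupport hx, zero_smul, zero_smul]
  -- the time derivative through the representatives
  have hdt : ∀ x, deriv (fun σ => locVelocity χ u σ x) s =
      χ x • ((Δ U) x - convect U U x - gradient P x) := by
    intro x
    rw [deriv_locVelocity_eq hsol hχ hs x]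
    by_cases hx : x ∈ tsupport χ
    · obtain ⟨hgU, hgP⟩ := hgerm x (hKχ x hx)
      have hL : (Δ U) x = (Δ (u s)) x := (InnerProductSpace.laplacian_congr_nhds hgU).eq_of_nhds
      have hC : convect U U x = convect (u s) (u s) x := by
        simp only [convect, hgU.fderiv_eq, hUx x hx]
      have hG : gradient P x = gradient (p s) x := by
        simp only [gradient, hgP.fderiv_eq]
      rw [hL, hC, hG]
    · rw [image_eq_zero_of_notMem_tsupport hx, zero_smul, zero_smul]
  -- Step 1: `∫ ⟪∂ₜv, Ψ⟫ = ∫ ⟪ΔU, ψ⟫ - ∫ ⟪(U·∇)U, ψ⟫ - ∫ ⟪∇P, ψ⟫`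
  have hΨc : Continuous Ψ := hΨ.continuous
  have hψcont : Continuous ψ := hψ1.continuous
  have iL := integrable_inner_of_hasCompactSupport_right (continuous_laplacian hU2) hψcont hψc
  have iC : Integrable (fun x => ⟪convect U U x, ψ x⟫) :=
    integrable_inner_of_hasCompactSupport_right
      ((hU1.continuous_fderiv one_ne_zero).clm_apply hU.continuous) hψcont hψc
  have iG := integrable_inner_of_hasCompactSupport_right (continuous_gradient_of_contDiff hP1)
    hψcont hψc
  have iLC : Integrable (fun x => ⟪(Δ U) x, ψ x⟫ - ⟪convect U U x, ψ x⟫) := iL.sub iC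
  have e1 : ∫ x, ⟪deriv (fun σ => locVelocity χ u σ x) s, Ψ x⟫ =
      (∫ x, ⟪(Δ U) x, ψ x⟫) - (∫ x, ⟪convect U U x, ψ x⟫) - ∫ x, ⟪gradient P x, ψ x⟫ := by
    rw [← integral_sub iL iC, ← integral_sub iLC iG]
    refine integral_congr_ae (Eventually.of_forall fun x => ?_)
    simp only [hdt x, hψdef, inner_smul_left, inner_smul_right, inner_sub_left, RCLike.conj_to_real]
    ring
  -- Step 2: the three integrations by parts
  have eL : ∫ x, ⟪(Δ U) x, ψ x⟫ = ∫ x, ⟪U x, (Δ ψ) x⟫ := integral_inner_laplacian_comm hU2 hψ2 hψc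
  have eC : ∫ x, ⟪convect U U x, ψ x⟫ = -∫ x, ⟪U x, convect U ψ x⟫ := by
    have h0 := integral_inner_convect_add_eq_zero hU1 hU1 hψ1 hψc
    have hz : ∫ x, VectorCalculus.divergence U x * ⟪U x, ψ x⟫ = 0 := by
      refine integral_eq_zero_of_ae (Eventually.of_forall fun x => ?_)
      by_cases hx : x ∈ tsupport χ
      · have hdiv : VectorCalculus.divergence U x = 0 := by
          have hgU := (hgerm x (hKχ x hx)).1
          have : VectorCalculus.divergence U x = VectorCalculus.divergence (u s) x := by
            simp only [VectorCalculus.divergence, hgU.fderiv_eq]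
          rw [this, hsol.divFree s hs x (hχ.tsupport_subset_ball' hx)]
        simp [hdiv]
      · have : ψ x = 0 := image_eq_zero_of_notMem_tsupport fun h => hx (hψsupp h)
        simp [this]
    linarith
  have eP : ∫ x, ⟪gradient P x, ψ x⟫ = -∫ x, P x * VectorCalculus.divergence ψ x :=
    integral_inner_gradient_eq_neg_integral_mul_divergence hP1 hψ1 hψc
  -- Step 3: the pointwise expansion of `⟪U, Δψ⟫ + ⟪U, (U·∇)ψ⟫ + P div ψ`
  have hχd : ∀ x, DifferentiableAt ℝ χ x := fun x => hχ1.differentiable one_ne_zero x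
  have hΨd : ∀ x, DifferentiableAt ℝ Ψ x := fun x => hΨ1.differentiable one_ne_zero x
  have key : ∀ x, ⟪U x, (Δ ψ) x⟫ + ⟪U x, convect U ψ x⟫ + P x * VectorCalculus.divergence ψ x =
      ⟪locVelocity χ u s x, (Δ Ψ) x⟫ + ⟪U x, fderiv ℝ Ψ x ((2 : ℝ) • gradient χ x)⟫ +
        ⟪locForce χ u p s x, Ψ x⟫ + ⟪U x, fderiv ℝ Ψ x (locVelocity χ u s x)⟫ := by
    intro x
    have hΔ : (Δ ψ) x = χ x • (Δ Ψ) x + (2 : ℝ) • fderiv ℝ Ψ x (gradient χ x) + ((Δ χ) x) • Ψ x :=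
      laplacian_smul_field hχ2 hΨ x
    have hcv : convect U ψ x = ⟪U x, gradient χ x⟫ • Ψ x + χ x • convect U Ψ x :=
      convect_smul_field (hχd x) (hΨd x)
    have hdv : VectorCalculus.divergence ψ x = ⟪Ψ x, gradient χ x⟫ := by
      rw [hψdef, divergence_smul_apply (hχd x) (hΨd x), hΨdiv x, mul_zero, zero_add]
    by_cases hx : x ∈ tsupport χ
    · rw [hΔ, hcv, hdv, hvU x, locForce_apply, ← hUx x hx, ← hPx x hx]
      have hg : ⟪U x, gradient χ x⟫ = fderiv ℝ χ x (U x) := by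
        rw [real_inner_comm, gradient, InnerProductSpace.toDual_symm_apply]
      simp only [inner_add_right, inner_add_left, inner_smul_right, inner_smul_left, map_smul,
        convect, RCLike.conj_to_real, hg]
      rw [real_inner_comm (Ψ x) (gradient χ x), real_inner_comm (Ψ x) (U x)]
      ring
    · have hχ0 : χ x = 0 := image_eq_zero_of_notMem_tsupport hx
      have hψx : x ∉ tsupport ψ := fun h => hx (hψsupp h)
      obtain ⟨-, hD0, hg0, hΔ0⟩ := (hχ.eventually_derivs_eq_zero hx).self_of_nhds
      have hf0 : locForce χ u p s x = 0 := by simp [locForce_apply, hD0, hg0, hΔ0]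
      have hv0 : locVelocity χ u s x = 0 := locVelocity_eq_zero_of_notMem hx u s
      rw [laplacian_eq_zero_of_notMem_tsupport hψx, divergence_eq_zero_of_notMem_tsupport hψx,
        hf0, hv0, hg0]
      simp [convect, fderiv_of_notMem_tsupport ℝ hψx]
  -- Step 4: integrate the expansion
  have hcU : Continuous U := hU.continuous
  have hDΨ : Continuous (fderiv ℝ Ψ) := hΨ1.continuous_fderiv one_ne_zero
  have hv_cont : Continuous (locVelocity χ u s) := (contDiff_locVelocity hsol hχ hs).continuous
  have hv_c : HasCompactSupport (locVelocity χ u s) := hasCompactSupport_locVelocity hχ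
  have hf_cont : Continuous (locForce χ u p s) := (contDiff_locForce hsol hχ hs).continuous
  have hf_c : HasCompactSupport (locForce χ u p s) := hasCompactSupport_locForce hχ
  have hgχc : HasCompactSupport (gradient χ) :=
    hχ.hasCompactSupport.mono' fun x hx => by
      by_contra h; exact hx (gradient_eq_zero_of_notMem_tsupport h)
  have j1 : Integrable (fun x => ⟪locVelocity χ u s x, (Δ Ψ) x⟫) :=
    integrable_inner_of_hasCompactSupport_left hv_cont (continuous_laplacian hΨ) hv_c
  have j2 : Integrable (fun x => ⟪U x, fderiv ℝ Ψ x ((2 : ℝ) • gradient χ x)⟫) :=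
    integrable_inner_of_hasCompactSupport_right hcU
      (hDΨ.clm_apply (show Continuous (fun x => (2 : ℝ) • gradient χ x) from
        (continuous_gradient_of_contDiff hχ1).const_smul (2 : ℝ)))
      (hχ.hasCompactSupport.mono' fun x hx => by
        by_contra h
        apply hx
        show fderiv ℝ Ψ x ((2 : ℝ) • gradient χ x) = 0
        rw [gradient_eq_zero_of_notMem_tsupport h, smul_zero, map_zero])
  have j3 : Integrable (fun x => ⟪locForce χ u p s x, Ψ x⟫) :=
    integrable_inner_of_hasCompactSupport_left hf_cont hΨc hf_c
  have j4 : Integrable (fun x => ⟪U x, fderiv ℝ Ψ x (locVelocity χ u s x)⟫) :=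
    integrable_inner_of_hasCompactSupport_right hcU (hDΨ.clm_apply hv_cont)
      (hv_c.mono' fun x hx => by
        by_contra h
        apply hx
        show fderiv ℝ Ψ x (locVelocity χ u s x) = 0
        rw [image_eq_zero_of_notMem_tsupport h, map_zero])
  have iUL : Integrable (fun x => ⟪U x, (Δ ψ) x⟫) :=
    integrable_inner_of_hasCompactSupport_right hcU (continuous_laplacian hψ2)
      (hψc.mono' fun x hx => by
        by_contra h
        exact hx (laplacian_eq_zero_of_notMem_tsupport h))
  have iUC : Integrable (fun x => ⟪U x, convect U ψ x⟫) :=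
    integrable_inner_of_hasCompactSupport_right hcU
      ((hψ1.continuous_fderiv one_ne_zero).clm_apply hcU)
      (hψc.mono' fun x hx => by
        by_contra h
        apply hx
        show convect U ψ x = 0
        rw [convect, fderiv_of_notMem_tsupport ℝ h]
        rfl)
  have iPD : Integrable (fun x => P x * VectorCalculus.divergence ψ x) := by
    refine (hP.continuous.mul (continuous_divergence (hψ1.continuous_fderiv one_ne_zero)))
      |>.integrable_of_hasCompactSupport (hψc.mono' fun x hx => ?_)
    by_contra h
    apply hx
    show P x * VectorCalculus.divergence ψ x = 0
    rw [divergence_eq_zero_of_notMem_tsupport h, mul_zero]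
  have iULC : Integrable (fun x => ⟪U x, (Δ ψ) x⟫ + ⟪U x, convect U ψ x⟫) := iUL.add iUC
  have j12 : Integrable (fun x => ⟪locVelocity χ u s x, (Δ Ψ) x⟫ +
      ⟪U x, fderiv ℝ Ψ x ((2 : ℝ) • gradient χ x)⟫) := j1.add j2
  have j123 : Integrable (fun x => ⟪locVelocity χ u s x, (Δ Ψ) x⟫ +
      ⟪U x, fderiv ℝ Ψ x ((2 : ℝ) • gradient χ x)⟫ + ⟪locForce χ u p s x, Ψ x⟫) := j12.add j3
  have e4 : (∫ x, ⟪U x, (Δ ψ) x⟫) + (∫ x, ⟪U x, convect U ψ x⟫) +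
      ∫ x, P x * VectorCalculus.divergence ψ x =
      (∫ x, ⟪locVelocity χ u s x, (Δ Ψ) x⟫) + (∫ x, ⟪U x, fderiv ℝ Ψ x ((2 : ℝ) • gradient χ x)⟫) +
        (∫ x, ⟪locForce χ u p s x, Ψ x⟫) + ∫ x, ⟪U x, fderiv ℝ Ψ x (locVelocity χ u s x)⟫ := by
    rw [← integral_add iUL iUC, ← integral_add iULC iPD, ← integral_add j1 j2,
      ← integral_add j12 j3, ← integral_add j123 j4]
    exact integral_congr_ae (Eventually.of_forall key)
  -- Step 5: the extension `ũ` in place of `U` (they agree where the other factor lives)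
  have e5 : ∫ x, ⟪locExtension x₁ R u s x, fderiv ℝ Ψ x (locVelocity χ u s x)⟫ =
      ∫ x, ⟪U x, fderiv ℝ Ψ x (locVelocity χ u s x)⟫ := by
    refine integral_congr_ae (Eventually.of_forall fun x => ?_)
    show ⟪locExtension x₁ R u s x, fderiv ℝ Ψ x (locVelocity χ u s x)⟫ =
      ⟪U x, fderiv ℝ Ψ x (locVelocity χ u s x)⟫
    by_cases hx : x ∈ tsupport χ
    · rw [hũx x hx, hUx x hx]
    · rw [locVelocity_eq_zero_of_notMem hx u s, map_zero, inner_zero_right, inner_zero_right]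
  have e6 : ∫ x, ⟪locExtension x₁ R u s x, fderiv ℝ Ψ x ((2 : ℝ) • gradient χ x)⟫ =
      ∫ x, ⟪U x, fderiv ℝ Ψ x ((2 : ℝ) • gradient χ x)⟫ := by
    refine integral_congr_ae (Eventually.of_forall fun x => ?_)
    show ⟪locExtension x₁ R u s x, fderiv ℝ Ψ x ((2 : ℝ) • gradient χ x)⟫ =
      ⟪U x, fderiv ℝ Ψ x ((2 : ℝ) • gradient χ x)⟫
    by_cases hx : x ∈ tsupport χ
    · rw [hũx x hx, hUx x hx]
    · rw [gradient_eq_zero_of_notMem_tsupport hx, smul_zero, map_zero, inner_zero_right,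
        inner_zero_right]
  rw [e1, eL, eC, eP, e5, e6]
  linarith [e4]

end Slice

end BGK2015

end Literature.Analysis.FluidPDE
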